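/-
Copyright: pub-rosobs cell (Resolution Observatory), carver gen 41.  Companion file; statements OURS, in
the cell's polynomial weighted-centre model `W(f)`.  Instrument — NOT a resolution theorem.
-/
import Literature.AlgebraicGeometry.Resolution.WeightedCentreStepUmbrellaReplay
import Literature.AlgebraicGeometry.Resolution.WeightedCentreBlockMaxima
import HarnessLib

/-!
# Concatenated centres on variable-disjoint blocks: the `∈` half of the merge rule

[cite: AbramovichTemkinWlodarczyk2024, Lemma 5.2.6 (p. 1576): `J` admissible for `I₁` and for `I₂` ⟹
admissible for `I₁ + I₂`; Thm. 5.3.1 (2) (p. 1578): `inv = max (b₁,…,b_k)` over admissible centres;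
§5.1 (p. 1575): admissibility via the monomial valuation].

In the polynomial model `W(f)` (`admissibleInvariants`): if `(Ψ₁, γ₁)` is a centre for `g` and `(Ψ₂, γ₂)`
is a centre for `h`, the two coordinate changes do not disturb the other summand (`Ψ₂⁻¹ g = g`,
`Ψ₁⁻¹ (Ψ₂⁻¹ h) = Ψ₂⁻¹ h` — automatic when `g`, `h` and the two changes live on disjoint blocks of
variables: `merge_mem_admissibleInvariants_add_of_vars`) and the cocharacters have disjoint supports, then the
CONCATENATED centre `(Ψ₁ ∘ Ψ₂, γ₁ + γ₂)` is a centre for `g + h` (`IsCentreFor.concat`) and its invariant is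
the sorted merge of the two invariants (`exps_add_eq`).  Hence

* `merge_mem_admissibleInvariants_add`: `sort (b₁ ++ b₂) ∈ W(g + h)` for `b₁ = exps γ₁ ∈ W(g)`,
  `b₂ = exps γ₂ ∈ W(h)` so presented — the LOWER BOUND `max W(g + h) ≥ merge (max W g, max W h)` of the
  cell's merge-rule census (engine 1, FE32 §4 / FE33 §3: 0 of 26 185 decided records below the merge;
  requests R8 / N3), now a kernel fact for every pair of block centres;
* `isMaxInv_X_sq_add_X_sq_charTwo`: the merge rule is NOT an equality in positive characteristic —
  over a field of characteristic `2`, `max W(X_i² + X_j²) = (2)` although both blocks have `max W = (2)`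
  (`isMaxInv_X_pow`) and the merge `(2, 2)` is admissible (`pair_mem_admissibleInvariants_X_sq_add_X_sq`):
  the census's INTERACT mechanism `(x + y)² = x² + y²` in its smallest instance.

The equality `max W(g ⊕ h) = merge` in characteristic `0` (census: 3367/3367) is data, not claimed here.
-/

noncomputable section

open MvPolynomial

namespace Literature.AlgebraicGeometry.Resolution.WeightedBlowup

variable {k : Type*} [Field k] {N : ℕ}

/-! ## `exps` of a concatenated cocharacter -/

/-- For cocharacters with disjoint supports, `exps (γ₁ + γ₂)` is a permutation of `exps γ₁ ++ exps γ₂`.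
(derived here) [cite: AbramovichTemkinWlodarczyk2024, §5.1 (p. 1575) (the invariant lists the exponents
`a_i = 1/γ_i` of the centre variables increasingly)] -/
theorem exps_add_perm {γ₁ γ₂ : Fin N → ℚ} (h : ∀ x, γ₁ x = 0 ∨ γ₂ x = 0) :
    (exps (γ₁ + γ₂)).Perm (exps γ₁ ++ exps γ₂) := by
  classical
  unfold exps
  refine (List.perm_insertionSort _ _).trans
    (List.Perm.trans ?_ ((List.perm_insertionSort _ _).append (List.perm_insertionSort _ _)).symm)
  -- the index lists: `{γ₁ + γ₂ ≠ 0} = {γ₁ ≠ 0} ⊔ {γ₂ ≠ 0}`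
  have hidx : ((Finset.univ.filter fun x => (γ₁ + γ₂) x ≠ 0).toList).Perm
      ((Finset.univ.filter fun x => γ₁ x ≠ 0).toList ++ (Finset.univ.filter fun x => γ₂ x ≠ 0).toList) := by
    apply List.perm_of_nodup_nodup_toFinset_eq (Finset.nodup_toList _)
    · refine List.nodup_append'.2 ⟨Finset.nodup_toList _, Finset.nodup_toList _, ?_⟩
      intro x hx₁ hx₂
      rw [Finset.mem_toList, Finset.mem_filter] at hx₁ hx₂
      rcases h x with h0 | h0
      · exact hx₁.2 h0
      · exact hx₂.2 h0
    · ext x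
      simp only [List.mem_toFinset, Finset.mem_toList, Finset.mem_filter, Finset.mem_univ, true_and,
        List.mem_append, Pi.add_apply]
      rcases h x with h0 | h0 <;> simp [h0]
  refine (hidx.map _).trans (List.Perm.of_eq ?_)
  rw [List.map_append]
  congr 1
  · apply List.map_congr_left
    intro x hx
    rw [Finset.mem_toList, Finset.mem_filter] at hx
    have h2 : γ₂ x = 0 := (h x).resolve_left hx.2
    simp [Pi.add_apply, h2]
  · apply List.map_congr_left
    intro x hx
    rw [Finset.mem_toList, Finset.mem_filter] at hx
    have h1 : γ₁ x = 0 := (h x).resolve_right hx.2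
    simp [Pi.add_apply, h1]

/-- **The invariant of a concatenated centre is the sorted merge**: for cocharacters with disjoint
supports, `exps (γ₁ + γ₂) = sort (exps γ₁ ++ exps γ₂)`. (derived here)
[cite: AbramovichTemkinWlodarczyk2024, §5.1 (p. 1575)] -/
theorem exps_add_eq {γ₁ γ₂ : Fin N → ℚ} (h : ∀ x, γ₁ x = 0 ∨ γ₂ x = 0) :
    exps (γ₁ + γ₂) = (exps γ₁ ++ exps γ₂).insertionSort (· ≤ ·) :=
  List.Perm.eq_of_sortedLE (exps_sorted _).sortedLE List.sortedLE_insertionSort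
    ((exps_add_perm h).trans (List.perm_insertionSort _ _).symm)

/-! ## Concatenation of centres -/

/-- An algebra endomorphism fixing every variable that occurs in `P` fixes `P` (plumbing). [folklore] -/
private theorem algHom_eq_self_of_forall_vars {σ K : Type*} [CommSemiring K]
    (Φ : MvPolynomial σ K →ₐ[K] MvPolynomial σ K) {P : MvPolynomial σ K}
    (h : ∀ x ∈ P.vars, Φ (X x) = X x) : Φ P = P := by
  change Φ.toRingHom P = RingHom.id _ P
  refine hom_congr_vars ?_ (fun x hx _ => ?_) rfl
  · ext c
    simp
  · simpa using h x hx

/-- An algebra automorphism fixing every variable that occurs in `P` fixes `P` (plumbing). [folklore] -/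
private theorem algEquiv_eq_self_of_forall_vars {σ K : Type*} [CommSemiring K]
    (Φ : MvPolynomial σ K ≃ₐ[K] MvPolynomial σ K) {P : MvPolynomial σ K}
    (h : ∀ x ∈ P.vars, Φ (X x) = X x) : Φ P = P :=
  algHom_eq_self_of_forall_vars (Φ : MvPolynomial σ K →ₐ[K] MvPolynomial σ K) h

/-- **Weights of a sum of disjointly admissible pieces.** `γ₁` admissible for `g`, `γ₂` admissible for `h`,
both non-negative ⟹ `γ₁ + γ₂` admissible for `g + h`. (derived here: monotonicity in the weights and
Lemma 5.2.6 for sums) [cite: AbramovichTemkinWlodarczyk2024, Lemma 5.2.6 (p. 1576) and Rem. 2.4.2 (p. 1568)] -/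
theorem IsAdmissibleFor.add_of_add {γ₁ γ₂ : Fin N → ℚ} {g h : MvPolynomial (Fin N) k}
    (hγ₁ : ∀ i, 0 ≤ γ₁ i) (hγ₂ : ∀ i, 0 ≤ γ₂ i) (hg : IsAdmissibleFor γ₁ g) (hh : IsAdmissibleFor γ₂ h) :
    IsAdmissibleFor (γ₁ + γ₂) (g + h) :=
  (hg.mono fun i => by simpa using hγ₂ i).add (hh.mono fun i => by simpa using hγ₁ i)

/-- **Concatenated centre.** If `(Ψ₁, γ₁)` is a centre for `g`, `(Ψ₂, γ₂)` is a centre for `h`, `Ψ₂⁻¹`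
fixes `g` and `Ψ₁⁻¹` fixes `Ψ₂⁻¹ h`, then `(Ψ₁.trans Ψ₂, γ₁ + γ₂)` — inverse `Ψ₁⁻¹ ∘ Ψ₂⁻¹` — is a centre
for `g + h`. (derived here) [cite: AbramovichTemkinWlodarczyk2024, Lemma 5.2.6 (p. 1576)
(`I₁`- and `I₂`-admissible ⟹ `(I₁ + I₂)`-admissible) and Lemma 5.2.10 (p. 1577)] -/
theorem IsCentreFor.concat {g h : MvPolynomial (Fin N) k}
    {Ψ₁ Ψ₂ : MvPolynomial (Fin N) k ≃ₐ[k] MvPolynomial (Fin N) k} {γ₁ γ₂ : Fin N → ℚ}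
    (hg : IsCentreFor g Ψ₁ γ₁) (hh : IsCentreFor h Ψ₂ γ₂) (hfix₂ : Ψ₂.symm g = g)
    (hfix₁ : Ψ₁.symm (Ψ₂.symm h) = Ψ₂.symm h) :
    IsCentreFor (g + h) (Ψ₁.trans Ψ₂) (γ₁ + γ₂) := by
  refine ⟨forall_constantCoeff_trans_X hg.1 hh.1, fun i => add_nonneg (hg.2.1 i) (hh.2.1 i), ?_⟩
  rw [AlgEquiv.symm_trans_apply, map_add, map_add, hfix₂, hfix₁]
  exact IsAdmissibleFor.add_of_add hg.2.1 hh.2.1 hg.2.2 hh.2.2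

/-- **The `∈` half of the merge rule (lower bound `max W(g ⊕ h) ≥ merge`).** With the hypotheses of
`IsCentreFor.concat` and disjointly supported cocharacters, the sorted merge of the two invariants is an
admissible invariant of the sum: `sort (exps γ₁ ++ exps γ₂) ∈ W(g + h)`. (derived here)
[cite: AbramovichTemkinWlodarczyk2024, Lemma 5.2.6 (p. 1576) and Thm. 5.3.1 (2) (p. 1578)] -/
theorem merge_mem_admissibleInvariants_add {g h : MvPolynomial (Fin N) k}
    {Ψ₁ Ψ₂ : MvPolynomial (Fin N) k ≃ₐ[k] MvPolynomial (Fin N) k} {γ₁ γ₂ : Fin N → ℚ}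
    (hg : IsCentreFor g Ψ₁ γ₁) (hh : IsCentreFor h Ψ₂ γ₂) (hfix₂ : Ψ₂.symm g = g)
    (hfix₁ : Ψ₁.symm (Ψ₂.symm h) = Ψ₂.symm h) (hdisj : ∀ x, γ₁ x = 0 ∨ γ₂ x = 0) :
    (exps γ₁ ++ exps γ₂).insertionSort (· ≤ ·) ∈ admissibleInvariants (g + h) := by
  rw [← exps_add_eq hdisj]
  exact exps_mem_admissibleInvariants (hg.concat hh hfix₂ hfix₁)

/-- **Block form.** If `Ψ₂⁻¹` fixes every variable of `g` and `Ψ₁⁻¹` fixes every variable of `Ψ₂⁻¹ h`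
(e.g. `g`, `Ψ₁` on one block of variables and `h`, `Ψ₂` on a disjoint one), the sorted merge of the two
invariants lies in `W(g + h)`. (derived here) [cite: AbramovichTemkinWlodarczyk2024, Lemma 5.2.6 (p. 1576)
and Thm. 5.3.1 (2) (p. 1578)] -/
theorem merge_mem_admissibleInvariants_add_of_vars {g h : MvPolynomial (Fin N) k}
    {Ψ₁ Ψ₂ : MvPolynomial (Fin N) k ≃ₐ[k] MvPolynomial (Fin N) k} {γ₁ γ₂ : Fin N → ℚ}
    (hg : IsCentreFor g Ψ₁ γ₁) (hh : IsCentreFor h Ψ₂ γ₂) (h₂ : ∀ x ∈ g.vars, Ψ₂.symm (X x) = X x)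
    (h₁ : ∀ x ∈ (Ψ₂.symm h).vars, Ψ₁.symm (X x) = X x) (hdisj : ∀ x, γ₁ x = 0 ∨ γ₂ x = 0) :
    (exps γ₁ ++ exps γ₂).insertionSort (· ≤ ·) ∈ admissibleInvariants (g + h) :=
  merge_mem_admissibleInvariants_add hg hh (algEquiv_eq_self_of_forall_vars Ψ₂.symm h₂)
    (algEquiv_eq_self_of_forall_vars Ψ₁.symm h₁) hdisj

/-- **Coordinate form** (both changes trivial): `γ₁` admissible for `g`, `γ₂` admissible for `h`,
non-negative with disjoint supports ⟹ `sort (exps γ₁ ++ exps γ₂) ∈ W(g + h)` — the concatenated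
coordinate centre of the cell's merge-rule census. (derived here)
[cite: AbramovichTemkinWlodarczyk2024, Lemma 5.2.6 (p. 1576) and §5.1 (p. 1575)] -/
theorem merge_mem_admissibleInvariants_add_refl {g h : MvPolynomial (Fin N) k} {γ₁ γ₂ : Fin N → ℚ}
    (hγ₁ : ∀ i, 0 ≤ γ₁ i) (hγ₂ : ∀ i, 0 ≤ γ₂ i) (hg : IsAdmissibleFor γ₁ g) (hh : IsAdmissibleFor γ₂ h)
    (hdisj : ∀ x, γ₁ x = 0 ∨ γ₂ x = 0) :
    (exps γ₁ ++ exps γ₂).insertionSort (· ≤ ·) ∈ admissibleInvariants (g + h) :=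
  merge_mem_admissibleInvariants_add (Ψ₁ := AlgEquiv.refl) (Ψ₂ := AlgEquiv.refl)
    ⟨fun x => constantCoeff_X k x, hγ₁, hg⟩ ⟨fun x => constantCoeff_X k x, hγ₂, hh⟩ rfl rfl hdisj

/-- **`max W(g + h)` is not below the merge**: for any presented block centres as above, the maximum `a`
of `W(g + h)` satisfies `¬ a <_T sort (b₁ ++ b₂)`. (derived here)
[cite: AbramovichTemkinWlodarczyk2024, Thm. 5.3.1 (2) (p. 1578)] -/
theorem not_lt_merge_of_isMaxInv_add {g h : MvPolynomial (Fin N) k}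
    {Ψ₁ Ψ₂ : MvPolynomial (Fin N) k ≃ₐ[k] MvPolynomial (Fin N) k} {γ₁ γ₂ : Fin N → ℚ} {a : List ℚ}
    (ha : IsMaxInv (admissibleInvariants (g + h)) a)
    (hg : IsCentreFor g Ψ₁ γ₁) (hh : IsCentreFor h Ψ₂ γ₂) (hfix₂ : Ψ₂.symm g = g)
    (hfix₁ : Ψ₁.symm (Ψ₂.symm h) = Ψ₂.symm h) (hdisj : ∀ x, γ₁ x = 0 ∨ γ₂ x = 0) :
    ¬ ATW.TruncLex.lt a ((exps γ₁ ++ exps γ₂).insertionSort (· ≤ ·)) :=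
  ha.2 _ (merge_mem_admissibleInvariants_add hg hh hfix₂ hfix₁ hdisj)

/-! ## The merge rule is not an equality in positive characteristic -/

/-- The merge `(2, 2)` of the block maxima of `X_i²` and `X_j²` IS admissible for `X_i² + X_j²` (`i ≠ j`,
every field). (derived here) [cite: AbramovichTemkinWlodarczyk2024, §5.1 (p. 1575)] -/
theorem pair_mem_admissibleInvariants_X_sq_add_X_sq {i j : Fin N} (hij : i ≠ j) :
    [(2 : ℚ), 2] ∈ admissibleInvariants (X i ^ 2 + X j ^ 2 : MvPolynomial (Fin N) k) := by
  classical
  have h2 : (0 : ℕ) < 2 := by norm_num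
  have hmem := merge_mem_admissibleInvariants_add_refl (g := (X i ^ 2 : MvPolynomial (Fin N) k))
    (h := X j ^ 2) (isCentreFor_X_pow (k := k) i h2).2.1 (isCentreFor_X_pow (k := k) j h2).2.1
    (isCentreFor_X_pow (k := k) i h2).2.2 (isCentreFor_X_pow (k := k) j h2).2.2 (fun x => ?_)
  · rwa [exps_singleWeights i h2, exps_singleWeights j h2] at hmem
  · by_cases hx : x = i
    · right
      subst hx
      simp [singleWeights, hij]
    · left
      simp [singleWeights, hx]

/-- **In characteristic `2`, `max W(X_i² + X_j²) = (2)`, not the merge `(2, 2)`** (`i ≠ j`, any number of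
ambient variables): `X_i² + X_j² = (X_i + X_j)²` is a square in the regular system of parameters
`X_i + X_j, …`, so `W(X_i² + X_j²) = W(X_i²)` by transport. (derived here)
[cite: AbramovichTemkinWlodarczyk2024, Thm. 5.3.1 (2)–(3) (p. 1578) (independence of coordinates)] -/
theorem isMaxInv_X_sq_add_X_sq_charTwo [CharP k 2] {i j : Fin N} (hij : i ≠ j) :
    IsMaxInv (admissibleInvariants (X i ^ 2 + X j ^ 2 : MvPolynomial (Fin N) k)) [(2 : ℚ)] := by
  classical
  have hji : j ≠ i := fun h => hij h.symm
  have hi : i ∉ (X j : MvPolynomial (Fin N) k).vars := by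
    rw [vars_X]
    simpa using hij
  -- `Φ : X_i ↦ X_i + X_j` maps `X_i²` to `X_i² + X_j²` in characteristic 2
  have hΦ : addPolyShear i (X j) (X i ^ 2 : MvPolynomial (Fin N) k) = X i ^ 2 + X j ^ 2 := by
    rw [map_pow, addPolyShear_X_self_of_notMem i hi]
    have h2 : (2 : MvPolynomial (Fin N) k) = 0 := by
      have := CharP.cast_eq_zero (MvPolynomial (Fin N) k) 2
      simpa using this
    linear_combination (X i * X j) * h2
  have h0 : ∀ x, constantCoeff (addPolyShear i (X j) (X x : MvPolynomial (Fin N) k)) = 0 :=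
    constantCoeff_addPolyShear_X i (constantCoeff_X k j)
  rw [← hΦ, admissibleInvariants_map_eq _ h0]
  exact isMaxInv_X_pow i (by norm_num)

/-- … and the merge `(2, 2)` lies strictly below that maximum: `(2, 2) <_T (2)`. (derived here)
[cite: AbramovichTemkinWlodarczyk2024, §5.1 (p. 1575) (truncations are larger)] -/
theorem pair_lt_single_two : ATW.TruncLex.lt [(2 : ℚ), 2] [(2 : ℚ)] := by
  rw [ATW.TruncLex.cons_lt_cons]
  exact Or.inr ⟨rfl, ATW.TruncLex.cons_lt_nil _ _⟩

end Literature.AlgebraicGeometry.Resolution.WeightedBlowup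

-- #harness_tags
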